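import Summits.QuantumFields.BalabanUV.T4Continuum.Support.NE7CubeLandauChart
import Summits.QuantumFields.BalabanUV.T4Continuum.Support.NE7PairGlueStep
import Summits.QuantumFields.BalabanUV.T4Continuum.Support.PeriodicChoice
import HarnessLib

/-!
# NE7PairCubeChart — THE PINNED PAIR CHART ON A CUBE AND THE WRAPPED CHART FAMILY (F317, d = 4): for two unitary configurations `U′`, `U_s` with
# plaquettes `η`-close to `1`, a unitary site gauge `g` with `g(z) = 1` and `‖U_s(b)⁻¹(U′^{g})(b) − 1‖ ≤ 4·128·4³·(2R+3)ε′` on every bond from the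
# cube `|x − z|_∞ ≤ R`; and, for `(N·M)`-periodic data, an `N`-EQUIVARIANT family of such charts on the radius-`M` cubes around all block corners `M•ζ`

Cell `pub-balaban`, sub-cell t4, lineage `b2b-balaban-t4-ne7-p1` (CRUX PROVER NE7 #1 = OWNER of row NE7), gen 94; memo
`t4/b2b-balaban-t4-ne7-p1-g94/PAIR-REP-ROAD.md` §2.  File 3 of the road to the PAIR RESIDUAL SUP-REPRESENTATIVE (row NE3's binder `hleaves` of F314b, first
conjunct).  The ENGINE is gen 93's cube Landau chart `NE7CubeLandauChart.cube_landau_chart` (comb gauge + principal logarithms + the one-scale lattice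
Uhlenbeck lemma `NE7LatticeUhlenbeckBox.uhlenbeck_box`), applied to BOTH configurations on the SAME cube: `U′^{u′} = e^{A′}`, `U_s^{u_s} = e^{A_s}` with
`‖A′‖, ‖A_s‖ ≤ a := 128·4³·(2R+3)ε′`; the PAIR CHART is `g := u_s⁻¹·c·u′` with the constant `c := u_s(z)u′(z)⁻¹` (so `g(z) = 1`), and
`U_s(b)⁻¹U′^{g}(b) = u_s(y)⁻¹(e^{−A_s(b)} c e^{A′(b)} c⁻¹)u_s(y)` is within `2(e^{a} − 1) ≤ 4a` of `1`.
WHAT ([folklore]; 0 def, 0 sorry).  §1 `pair_cube_chart` (any centre `z`, radius `R`, the regime letters of `cube_landau_chart`).  §2 `exists_pair_chart_family`: for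
`(N·M)`-periodic `U′`, `U_s`: `g : Site 4 → (Site 4 → units)` with, for EVERY block index `ζ ∈ ℤ⁴`: `g ζ` unitary, `g ζ (M•ζ) = 1`, the pair letter on
the radius-`M` cube around `M•ζ`, and the equivariance `g (ζ + N e_i) (x + NM e_i) = g ζ x` (charts chosen on the period box `[0,N)⁴` and transported by the
period lattice — `PeriodicChoice`'s wrap map written as a lambda, no definition).
HONEST FRAMING: composition of gen 93's chart with elementary unitary bookkeeping; nothing of Bałaban's asserted; hleaves NOT discharged; NE7 NOT PROVED; spine
0∕9; finite T⁴ rung (B)+1 — NOT infinite volume, NOT mass gap, NOT `BetaPertH`, NOT Clay.  Axioms ⊆ {propext, Classical.choice, Quot.sound}.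
-/

set_option autoImplicit false

open scoped BigOperators Matrix Matrix.Norms.L2Operator
open Finset NormedSpace Set

namespace Summit.QuantumFields.BalabanUV.T4Continuum.NE7PairCubeChart

open Literature.MathematicalPhysics.QuantumFieldTheory.Balaban1983to89
open B7Prop1Explicit B7Prop2Explicit UnitaryModel MatrixNorms MatrixLog
open T4AveragingDeficitWall (IsUnitaryCfg SmallField)
open T4AveragingDeficitWallBoundary (IsPeriodicCfg periodBox mem_periodBox)
open NE7CubeLandauChart (cube_landau_chart)
open PeriodicChoice (periodic_vec wrap_add_smul_ediv wrap_mem_periodBox wrap_add_smul_e)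
open AveragingDeficitLiftPeriodic (hol_shift)

noncomputable section

variable {n : Type*} [Fintype n] [DecidableEq n] [Nonempty n]

/-! ## §1 The pinned pair chart on one cube -/

omit [Nonempty n] in
/-- `‖e^{A} − 1‖ ≤ 2‖A‖`-type bound: `‖A‖ ≤ a ≤ 1 ⟹ ‖e^{A} − 1‖ ≤ 2a`. [folklore] -/
theorem norm_exp_sub_one_le_two_mul {A : Matrix n n ℂ} {a : ℝ} (hA : ‖A‖ ≤ a) (ha : a ≤ 1) : ‖exp A - 1‖ ≤ 2 * a := by
  have h0 : 0 ≤ a := (norm_nonneg _).trans hA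
  have h1 := (norm_exp_sub_one_le_of_norm_le hA).1
  have h2 : Real.exp a - 1 ≤ 2 * a := by
    have h := Real.abs_exp_sub_one_le (x := a) (by rw [abs_of_nonneg h0]; exact ha)
    rw [abs_of_nonneg h0] at h
    exact (le_abs_self _).trans h
  linarith

/-- **THE PINNED PAIR CHART ON A CUBE**: two unitary configurations `U′`, `U_s` with `SmallField · η` (`η > 0`), a centre `z`, a radius `R` in the regime of
`cube_landau_chart`: there is a unitary site gauge `g` with `g z = 1` and `‖U_s(b)⁻¹(U′^{g})(b) − 1‖ ≤ 4·(128·4³·(2R+3)·ε′)` on every bond `b = ⟨x, x + e_κ⟩`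
with `|x − z|_∞ ≤ R`. [folklore] -/
theorem pair_cube_chart {U' Us : Site 4 → Fin 4 → (Matrix n n ℂ)ˣ} (hU' : IsUnitaryCfg U') (hUs : IsUnitaryCfg Us) {η ε' : ℝ} (hη : 0 < η)
    (hS' : SmallField U' η) (hSs : SmallField Us η) (R : ℕ) (z : Site 4)
    (hε' : η + 8 * (Real.pi / 2 * (3 * ((2 * R + 2 : ℕ) : ℝ) * η)) * (Real.exp (4 * (Real.pi / 2 * (3 * ((2 * R + 2 : ℕ) : ℝ) * η))) - 1) ≤ ε')
    (hR1 : 576 * (64 * ((4 : ℕ) : ℝ) ^ 3 * ((2 * R + 2 + 1 : ℕ) : ℝ)) ^ 2 * ε' ≤ 1)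
    (hR2 : (Fintype.card n : ℝ) * (1 + 2 * ((4 : ℕ) : ℝ) * ((2 * R + 2 + 1 : ℕ) : ℝ)) * (256 * ((4 : ℕ) : ℝ) ^ 3 * ((2 * R + 2 + 1 : ℕ) : ℝ) * ε') ≤ 1 / 2) :
    ∃ g : Site 4 → (Matrix n n ℂ)ˣ, (∀ x, g x ∈ unitaryUnits (Matrix n n ℂ)) ∧ g z = 1 ∧
      ∀ (x : Site 4) (κ : Fin 4), (∀ i, |x i - z i| ≤ (R : ℤ)) →
        ‖(((Us x κ)⁻¹ * gaugeAct g U' x κ : (Matrix n n ℂ)ˣ) : Matrix n n ℂ) - 1‖ ≤ 4 * (128 * ((4 : ℕ) : ℝ) ^ 3 * ((2 * R + 2 + 1 : ℕ) : ℝ) * ε') := by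
  letI : CStarAlgebra (Matrix n n ℂ) := {}
  obtain ⟨u', A', hu', hA'rep, -, hA'n, -⟩ := cube_landau_chart hU' hη hS' R z hε' hR1 hR2
  obtain ⟨us, As, hus, hAsrep, -, hAsn, -⟩ := cube_landau_chart hUs hη hSs R z hε' hR1 hR2
  set a : ℝ := 128 * ((4 : ℕ) : ℝ) ^ 3 * ((2 * R + 2 + 1 : ℕ) : ℝ) * ε' with ha
  -- `a ≤ 1` from (R1)
  have ha1 : a ≤ 1 := by
    have hX1 : (1 : ℝ) ≤ ((2 * R + 2 + 1 : ℕ) : ℝ) := by exact_mod_cast (by omega : 1 ≤ 2 * R + 2 + 1)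
    have hε'0 : 0 ≤ ε' := by
      have h0 : 0 ≤ 8 * (Real.pi / 2 * (3 * ((2 * R + 2 : ℕ) : ℝ) * η)) * (Real.exp (4 * (Real.pi / 2 * (3 * ((2 * R + 2 : ℕ) : ℝ) * η))) - 1) := by
        have : 0 ≤ Real.exp (4 * (Real.pi / 2 * (3 * ((2 * R + 2 : ℕ) : ℝ) * η))) - 1 := by
          linarith [Real.add_one_le_exp (4 * (Real.pi / 2 * (3 * ((2 * R + 2 : ℕ) : ℝ) * η))),
            (by positivity : 0 ≤ 4 * (Real.pi / 2 * (3 * ((2 * R + 2 : ℕ) : ℝ) * η)))]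
        positivity
      linarith
    rw [ha]; push_cast at hR1 ⊢
    nlinarith [hX1, hε'0, mul_nonneg (by positivity : (0 : ℝ) ≤ ((2 * R + 2 + 1 : ℕ) : ℝ)) hε'0]
  -- the constant and the pair chart
  set c : (Matrix n n ℂ)ˣ := us z * (u' z)⁻¹ with hc
  have hcU : c ∈ unitaryUnits (Matrix n n ℂ) := (unitaryUnits _).mul_mem (hus z) ((unitaryUnits _).inv_mem (hu' z))
  refine ⟨fun x => (us x)⁻¹ * c * u' x, fun x => ?_, ?_, fun x κ hx => ?_⟩
  · exact (unitaryUnits _).mul_mem ((unitaryUnits _).mul_mem ((unitaryUnits _).inv_mem (hus x)) hcU) (hu' x)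
  · rw [hc]; group
  · -- `U_s⁻¹ U′^{g} = u_s(y)⁻¹ (E_s⁻¹ c E′ c⁻¹) u_s(y)` with `E′ = U′^{u′}(b)`, `E_s = U_s^{u_s}(b)`
    have hE' := hA'rep x κ hx
    have hEs := hAsrep x κ hx
    have hid : (Us x κ)⁻¹ * gaugeAct (fun x => (us x)⁻¹ * c * u' x) U' x κ
        = (us (x + e κ))⁻¹ * ((gaugeAct us Us x κ)⁻¹ * (c * gaugeAct u' U' x κ * c⁻¹)) * us (x + e κ) := by
      simp only [gaugeAct]; group
    rw [hid]
    have hEsU : gaugeAct us Us x κ ∈ unitaryUnits (Matrix n n ℂ) :=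
      (unitaryUnits _).mul_mem ((unitaryUnits _).mul_mem (hus x) (hUs x κ)) ((unitaryUnits _).inv_mem (hus _))
    have hE'U : gaugeAct u' U' x κ ∈ unitaryUnits (Matrix n n ℂ) :=
      (unitaryUnits _).mul_mem ((unitaryUnits _).mul_mem (hu' x) (hU' x κ)) ((unitaryUnits _).inv_mem (hu' _))
    have hcE : c * gaugeAct u' U' x κ * c⁻¹ ∈ unitaryUnits (Matrix n n ℂ) :=
      (unitaryUnits _).mul_mem ((unitaryUnits _).mul_mem hcU hE'U) ((unitaryUnits _).inv_mem hcU)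
    rw [NE7PairGlueStep.norm_conj_sub_one (hus _)]
    -- `‖E_s⁻¹ (cE′c⁻¹) − 1‖ ≤ ‖E_s − 1‖ + ‖E′ − 1‖`
    have h1 : ‖((((gaugeAct us Us x κ)⁻¹ * (c * gaugeAct u' U' x κ * c⁻¹)) : (Matrix n n ℂ)ˣ) : Matrix n n ℂ) - 1‖
        ≤ ‖(((gaugeAct us Us x κ)⁻¹ : (Matrix n n ℂ)ˣ) : Matrix n n ℂ) - 1‖ + ‖((c * gaugeAct u' U' x κ * c⁻¹ : (Matrix n n ℂ)ˣ) : Matrix n n ℂ) - 1‖ := by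
      rw [Units.val_mul]
      have hid2 : (((gaugeAct us Us x κ)⁻¹ : (Matrix n n ℂ)ˣ) : Matrix n n ℂ) * ((c * gaugeAct u' U' x κ * c⁻¹ : (Matrix n n ℂ)ˣ) : Matrix n n ℂ) - 1
          = (((gaugeAct us Us x κ)⁻¹ : (Matrix n n ℂ)ˣ) : Matrix n n ℂ) * (((c * gaugeAct u' U' x κ * c⁻¹ : (Matrix n n ℂ)ˣ) : Matrix n n ℂ) - 1)
            + ((((gaugeAct us Us x κ)⁻¹ : (Matrix n n ℂ)ˣ) : Matrix n n ℂ) - 1) := by noncomm_ring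
      rw [hid2]
      refine (norm_add_le _ _).trans ?_
      rw [CStarRing.norm_mem_unitary_mul _ ((unitaryUnits _).inv_mem hEsU), add_comm]
    have h2 : ‖(((gaugeAct us Us x κ)⁻¹ : (Matrix n n ℂ)ˣ) : Matrix n n ℂ) - 1‖ ≤ 2 * a := by
      rw [NE7PairGlueStep.norm_inv_sub_one hEsU, hEs, val_expUnit]
      exact norm_exp_sub_one_le_two_mul (hAsn x κ hx) ha1
    have h3 : ‖((c * gaugeAct u' U' x κ * c⁻¹ : (Matrix n n ℂ)ˣ) : Matrix n n ℂ) - 1‖ ≤ 2 * a := by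
      have hid3 : ((c * gaugeAct u' U' x κ * c⁻¹ : (Matrix n n ℂ)ˣ) : Matrix n n ℂ) - 1
          = (c : Matrix n n ℂ) * ((((gaugeAct u' U' x κ : (Matrix n n ℂ)ˣ)) : Matrix n n ℂ) - 1) * ((c⁻¹ : (Matrix n n ℂ)ˣ) : Matrix n n ℂ) := by
        rw [mul_sub, sub_mul, mul_one, Units.val_mul, Units.val_mul, Units.mul_inv]
      rw [hid3, CStarRing.norm_mul_mem_unitary _ ((unitaryUnits _).inv_mem hcU), CStarRing.norm_mem_unitary_mul _ hcU, hE', val_expUnit]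
      exact norm_exp_sub_one_le_two_mul (hA'n x κ hx) ha1
    calc _ ≤ 2 * a + 2 * a := h1.trans (add_le_add h2 h3)
      _ = 4 * a := by ring

/-! ## §2 The wrapped chart family for periodic data -/

omit [Nonempty n] in
/-- Gauging commutes with a simultaneous shift of the gauge and of a configuration periodic under that shift. [folklore] -/
theorem gaugeAct_shift {U : Site 4 → Fin 4 → (Matrix n n ℂ)ˣ} {s : Site 4} (hUs : ∀ x κ, U (x + s) κ = U x κ)
    (h : Site 4 → (Matrix n n ℂ)ˣ) (x : Site 4) (κ : Fin 4) :
    gaugeAct (fun y => h (y + s)) U x κ = gaugeAct h U (x + s) κ := by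
  simp only [gaugeAct, add_right_comm x (e κ) s, hUs]

/-- **THE WRAPPED CHART FAMILY**: for `(N·M)`-periodic unitary `U′`, `U_s` with `SmallField · η` in the regime of `cube_landau_chart` at radius `M`:
a family `g : Site 4 → (Site 4 → units)`, indexed by ALL block indices `ζ ∈ ℤ⁴`, of unitary site gauges with `g ζ (M•ζ) = 1`, the pair letter
`‖U_s(b)⁻¹(U′^{g ζ})(b) − 1‖ ≤ η_ch := 4·128·4³·(2M+3)ε′` on every bond from the cube `|x − M•ζ|_∞ ≤ M`, and the `N`-equivariance
`g (ζ + N e_i) (x + NM e_i) = g ζ x`. [folklore] -/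
theorem exists_pair_chart_family {U' Us : Site 4 → Fin 4 → (Matrix n n ℂ)ˣ} (hU' : IsUnitaryCfg U') (hUs : IsUnitaryCfg Us) {N M : ℕ}
    (hU'P : IsPeriodicCfg U' ((N * M : ℕ) : ℤ)) (hUsP : IsPeriodicCfg Us ((N * M : ℕ) : ℤ)) {η ε' : ℝ} (hη : 0 < η)
    (hS' : SmallField U' η) (hSs : SmallField Us η)
    (hε' : η + 8 * (Real.pi / 2 * (3 * ((2 * M + 2 : ℕ) : ℝ) * η)) * (Real.exp (4 * (Real.pi / 2 * (3 * ((2 * M + 2 : ℕ) : ℝ) * η))) - 1) ≤ ε')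
    (hR1 : 576 * (64 * ((4 : ℕ) : ℝ) ^ 3 * ((2 * M + 2 + 1 : ℕ) : ℝ)) ^ 2 * ε' ≤ 1)
    (hR2 : (Fintype.card n : ℝ) * (1 + 2 * ((4 : ℕ) : ℝ) * ((2 * M + 2 + 1 : ℕ) : ℝ)) * (256 * ((4 : ℕ) : ℝ) ^ 3 * ((2 * M + 2 + 1 : ℕ) : ℝ) * ε') ≤ 1 / 2) :
    ∃ g : Site 4 → Site 4 → (Matrix n n ℂ)ˣ,
      (∀ ζ x, g ζ x ∈ unitaryUnits (Matrix n n ℂ)) ∧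
      (∀ ζ, g ζ ((M : ℤ) • ζ) = 1) ∧
      (∀ (ζ x : Site 4) (κ : Fin 4), (∀ i, |x i - (M : ℤ) * ζ i| ≤ (M : ℤ)) →
        ‖(((Us x κ)⁻¹ * gaugeAct (g ζ) U' x κ : (Matrix n n ℂ)ˣ) : Matrix n n ℂ) - 1‖
          ≤ 4 * (128 * ((4 : ℕ) : ℝ) ^ 3 * ((2 * M + 2 + 1 : ℕ) : ℝ) * ε')) ∧
      (∀ (ζ x : Site 4) (i : Fin 4), g (ζ + (N : ℤ) • e i) (x + ((N * M : ℕ) : ℤ) • e i) = g ζ x) := by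
  classical
  -- one pinned pair chart at every centre `M•z`
  have hchart : ∀ z : Site 4, ∃ g : Site 4 → (Matrix n n ℂ)ˣ, (∀ x, g x ∈ unitaryUnits (Matrix n n ℂ)) ∧ g ((M : ℤ) • z) = 1 ∧
      ∀ (x : Site 4) (κ : Fin 4), (∀ i, |x i - ((M : ℤ) • z) i| ≤ (M : ℤ)) →
        ‖(((Us x κ)⁻¹ * gaugeAct g U' x κ : (Matrix n n ℂ)ˣ) : Matrix n n ℂ) - 1‖ ≤ 4 * (128 * ((4 : ℕ) : ℝ) ^ 3 * ((2 * M + 2 + 1 : ℕ) : ℝ) * ε') :=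
    fun z => pair_cube_chart hU' hUs hη hS' hSs M ((M : ℤ) • z) hε' hR1 hR2
  choose h hhU hh1 hherr using hchart
  -- the wrap map `ζ ↦ ζ mod N` and the quotient `q ζ = ζ div N`, as lambdas
  let wr : Site 4 → Site 4 := fun ζ i => ζ i % (N : ℤ)
  let q : Site 4 → Site 4 := fun ζ i => ζ i / (N : ℤ)
  have hdecomp : ∀ ζ : Site 4, wr ζ + (N : ℤ) • q ζ = ζ := fun ζ => wrap_add_smul_ediv N ζ
  -- the shift `M•(ζ − wr ζ) = (N·M)•q ζ` is a period vector of the data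
  have hshift : ∀ ζ : Site 4, (M : ℤ) • (ζ - wr ζ) = ((N * M : ℕ) : ℤ) • q ζ := by
    intro ζ
    have : ζ - wr ζ = (N : ℤ) • q ζ := by rw [sub_eq_iff_eq_add, add_comm]; exact (hdecomp ζ).symm
    rw [this, smul_smul]; push_cast; ring_nf
  have hperU' : ∀ (ζ x : Site 4) (κ : Fin 4), U' (x + (M : ℤ) • (ζ - wr ζ)) κ = U' x κ := by
    intro ζ x κ; rw [hshift]; exact periodic_vec (g := fun y => U' y κ) (N := ((N * M : ℕ) : ℤ)) (fun y i => hU'P y i κ) x (q ζ)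
  have hperUs : ∀ (ζ x : Site 4) (κ : Fin 4), Us (x + (M : ℤ) • (ζ - wr ζ)) κ = Us x κ := by
    intro ζ x κ; rw [hshift]; exact periodic_vec (g := fun y => Us y κ) (N := ((N * M : ℕ) : ℤ)) (fun y i => hUsP y i κ) x (q ζ)
  refine ⟨fun ζ x => h (wr ζ) (x - (M : ℤ) • (ζ - wr ζ)), fun ζ x => hhU _ _, fun ζ => ?_, fun ζ x κ hx => ?_, fun ζ x i => ?_⟩
  · -- pinning: `M•ζ − M•(ζ − wr ζ) = M•(wr ζ)`
    have : (M : ℤ) • ζ - (M : ℤ) • (ζ - wr ζ) = (M : ℤ) • wr ζ := by rw [smul_sub]; abel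
    simp only [this]; exact hh1 _
  · -- the pair letter, transported by the period shift
    set s : Site 4 := (M : ℤ) • (ζ - wr ζ) with hs
    have hg : gaugeAct (fun y => h (wr ζ) (y - s)) U' x κ = gaugeAct (h (wr ζ)) U' (x - s) κ := by
      have hU's : ∀ y κ, U' (y + (-s)) κ = U' y κ := by
        intro y κ'
        have := hperU' ζ (y + -s) κ'
        rw [neg_add_cancel_right] at this
        exact this.symm
      have := gaugeAct_shift hU's (h (wr ζ)) x κ
      simp only [← sub_eq_add_neg] at this
      exact this
    have hUsx : Us x κ = Us (x - s) κ := by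
      have := hperUs ζ (x - s) κ; rw [sub_add_cancel] at this; exact this
    rw [hg, hUsx]
    refine hherr (wr ζ) (x - s) κ (fun i => ?_)
    have hx' := hx i
    have hsi : s i = (M : ℤ) * (ζ i - wr ζ i) := rfl
    simp only [Pi.sub_apply, Pi.smul_apply, smul_eq_mul, hsi]
    have : x i - (M : ℤ) * (ζ i - wr ζ i) - (M : ℤ) * wr ζ i = x i - (M : ℤ) * ζ i := by ring
    rw [this]; exact hx'
  · -- equivariance
    have hwr : wr (ζ + (N : ℤ) • e i) = wr ζ := wrap_add_smul_e N ζ i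
    have harg : x + ((N * M : ℕ) : ℤ) • e i - (M : ℤ) • (ζ + (N : ℤ) • e i - wr (ζ + (N : ℤ) • e i)) = x - (M : ℤ) • (ζ - wr ζ) := by
      rw [hwr]
      have : (ζ + (N : ℤ) • e i - wr ζ) = (ζ - wr ζ) + (N : ℤ) • e i := by abel
      rw [this, smul_add, smul_smul, show ((M : ℤ) * (N : ℤ)) = ((N * M : ℕ) : ℤ) by push_cast; ring]; abel
    show h (wr (ζ + (N : ℤ) • e i)) (x + ((N * M : ℕ) : ℤ) • e i - (M : ℤ) • (ζ + (N : ℤ) • e i - wr (ζ + (N : ℤ) • e i)))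
      = h (wr ζ) (x - (M : ℤ) • (ζ - wr ζ))
    rw [harg, hwr]

end

end Summit.QuantumFields.BalabanUV.T4Continuum.NE7PairCubeChart
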